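import Summits.BirchSwinnertonDyer.BirchSwinnertonDyer.Theses.SchneiderFreeAdditiveX3
import HarnessLib

/-!
# Route `SchneiderFreeAdditiveX3` (rung K1 door, cell `bsd-schneider-ideate`): the support item `PartnerUpperRankZero` PROVED

Item `stmt-BirchSwinnertonDyer-19181` of route `route-BirchSwinnertonDyer-SchneiderFreeAdditiveX3`
(`Theses/SchneiderFreeAdditiveX3.lean`, rev 3, support, rank 9): from its six printed facts as explicit
antecedents (Delbourgo 1998 Prop. 4, Gross–Zagier–Kolyvagin rank/finiteness, modularity, a modular
parametrisation datum, Wuthrich 2014 Thm. 16 half and component) the UPPER half of BSD_p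
(`Typed.MissingUpperBoundAt Wd p`) on the rank-ZERO reducible semistable-twist rows (`ClassX3 Wd p`,
`Additive.SubSemistableTwist Wd p`, `r_an(Wd) = 0`, `p` odd). This is VERBATIM the tree theorem
`SchneiderFree.partnerUpperX3RankZero_of_facts` (`Theorems/SchneiderFreeSockets.lean`, p406720), the
re-keying of `Additive.ClassX3.missingUpperBoundAt_rankZero_of_subSemistableTwist`. Nothing new is
claimed; the printed facts stay hypotheses. HONEST FRAMING: closes a support item of a draft route;
neither the rung leaf nor BSD is touched.

References: Delbourgo, Compositio Math. 113 (1998) Prop. 4 [Delbourgo1998]; Wuthrich, J. London Math.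
Soc. 89 (2014) Thm. 16 [Wuthrich2014]; Miller, LMS J. Comput. Math. 14 (2011) Def. 1.1 [Miller2011LMS].
-/

set_option autoImplicit false

namespace Summit.BirchSwinnertonDyer.BirchSwinnertonDyer.Theorems

/-- **Item `PartnerUpperRankZero` of route `SchneiderFreeAdditiveX3` holds**: the six printed facts give
the upper half `Typed.MissingUpperBoundAt Wd p` on the rank-zero reducible semistable-twist rows at
every odd `p` — the tree theorem `SchneiderFree.partnerUpperX3RankZero_of_facts`.
[cite: Delbourgo1998, Prop. 4 (p. 144)] [cite: Wuthrich2014, Thm. 16 (p. 397)]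
[cite: Miller2011LMS, Def. 1.1] -/
theorem schneiderFreeAdditiveX3_partnerUpperRankZero_proof :
    Summit.BirchSwinnertonDyer.BirchSwinnertonDyer.Theses.SchneiderFreeAdditiveX3.PartnerUpperRankZero :=
  fun hDel hGZK hmod hmodD hW16 hWu ↦
    Summit.BirchSwinnertonDyer.BirchSwinnertonDyer.Theorems.SchneiderFree.partnerUpperX3RankZero_of_facts
      hDel hGZK hmod hmodD hW16 hWu

end Summit.BirchSwinnertonDyer.BirchSwinnertonDyer.Theorems
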